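import Summits.AtomisticToContinuum.HydrodynamicLimit.Theorems.BoltzmannGreenKubo.Negative.PiStatics
import Summits.AtomisticToContinuum.HydrodynamicLimit.Theorems.BoltzmannGreenKubo.Negative.TimeAverage
import Summits.AtomisticToContinuum.HydrodynamicLimit.Theorems.BoltzmannGreenKubo.Negative.MomentumWitness

/-!
# Mazur's floor for deterministic hard spheres, mechanised (helper file 6/7)

`mazur_floor`: for EVERY `N`, `σ ≤ 1/2`, `h > 0` and hard-sphere flow `Φ`, under the constant-profile local Gibbs law
`E[(h⁻¹∫₀ʰ Σᵢ g_M(vᵢ(r)) dr)²] ≥ (N+1) m²` — Cauchy–Schwarz against the conserved momentum `P = Σᵢ(vᵢ)₀`, with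
`E[A P] = E[F P] = (N+1)m` (Fubini + stationarity + conservation, files 1–4) and `E[P²] = N+1` (file 3).
refuter-cdisprove-stmt-AtomisticToContinuum-13985-0 (crux BoltzmannGreenKubo, stmt-13985; infrastructure of the Mazur-floor refutation `Negative/OrthMomentum.lean`, see `Cruxes/BoltzmannGreenKubo/Disproof.lean` §1d–§1h).
-/

noncomputable section

namespace Summit.AtomisticToContinuum.HydrodynamicLimit.Theorems

open MeasureTheory ProbabilityTheory Filter Topology Set
open Literature.Analysis.FluidPDE Literature.MathematicalPhysics.KineticTheory
open Literature.Analysis.UnboundedOperators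
open scoped InnerProductSpace

namespace BoltzmannGreenKuboOrthMomentum

section MazurFloor

variable {σ : ℝ} {N : ℕ}

/-- The observable `F = Σᵢ g_M(vᵢ)`. [folklore] -/
def Fobs (w : Config (N + 1) (Fin 3) T3) : ℝ := ∑ i, gM ((w i).2)

/-- The first component of the total momentum, `P = Σᵢ (vᵢ)₀`. [folklore] -/
def Pobs (w : Config (N + 1) (Fin 3) T3) : ℝ := ∑ i, (w i).2 0

/-- Helper for the Mazur-floor refutation (see the module docstring). [folklore] -/
theorem continuous_Fobs : Continuous (Fobs : Config (N + 1) (Fin 3) T3 → ℝ) := by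
  unfold Fobs
  refine continuous_finsetSum _ fun i _ => continuous_gM.comp ?_
  exact (continuous_apply i).snd

/-- Helper for the Mazur-floor refutation (see the module docstring). [folklore] -/
theorem measurable_Fobs : Measurable (Fobs : Config (N + 1) (Fin 3) T3 → ℝ) := by
  unfold Fobs
  refine Finset.measurable_sum _ fun i _ => continuous_gM.measurable.comp ?_
  exact (measurable_pi_apply i).snd

/-- Helper for the Mazur-floor refutation (see the module docstring). [folklore] -/
theorem abs_Fobs_le (w : Config (N + 1) (Fin 3) T3) : |Fobs w| ≤ 5 * ((N : ℝ) + 1) := by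
  unfold Fobs
  refine (Finset.abs_sum_le_sum_abs _ _).trans ?_
  calc ∑ i, |gM ((w i).2)| ≤ ∑ _i : Fin (N + 1), (5 : ℝ) := Finset.sum_le_sum fun i _ => abs_gM_le _
    _ = 5 * ((N : ℝ) + 1) := by simp [Finset.sum_const, Finset.card_univ, Fintype.card_fin]; ring

/-- Helper for the Mazur-floor refutation (see the module docstring). [folklore] -/
theorem measurable_Pobs : Measurable (Pobs : Config (N + 1) (Fin 3) T3 → ℝ) := by
  unfold Pobs
  refine Finset.measurable_sum _ fun i _ => ?_
  exact (EuclideanSpace.proj (𝕜 := ℝ) (0 : Fin 3)).continuous.measurable.comp (measurable_pi_apply i).snd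

/-- Helper for the Mazur-floor refutation (see the module docstring). [folklore] -/
theorem Pobs_eq_configMomentum (w : Config (N + 1) (Fin 3) T3) : Pobs w = (configMomentum w) 0 := by
  simp [Pobs, configMomentum]

/-- `P` is conserved on the good set. [folklore] -/
theorem Pobs_flow (Φ : HardSphereFlow (Torus.geometry (Fin 3)) (hsDiameter σ N) (N + 1))
    {z : Config (N + 1) (Fin 3) T3} (hz : z ∈ Φ.good) (t : ℝ) : Pobs (Φ.flow t z) = Pobs z := by
  rw [Pobs_eq_configMomentum, Pobs_eq_configMomentum, Φ.configMomentum_flow hz t]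

/-- Helper for the Mazur-floor refutation (see the module docstring). [folklore] -/
theorem Fobs_eq_velOf (w : Config (N + 1) (Fin 3) T3) : Fobs w = (fun v : Fin (N + 1) → V3 => ∑ i, gM (v i)) (velOf w) := rfl

/-- Helper for the Mazur-floor refutation (see the module docstring). [folklore] -/
theorem Pobs_eq_velOf (w : Config (N + 1) (Fin 3) T3) : Pobs w = (fun v : Fin (N + 1) → V3 => ∑ i, v i 0) (velOf w) := rfl

/-- Helper for the Mazur-floor refutation (see the module docstring). [folklore] -/
theorem Pobs_eq_velOf' : (Pobs : Config (N + 1) (Fin 3) T3 → ℝ) = fun w => (fun v : Fin (N + 1) → V3 => ∑ i, v i 0) (velOf w) := rfl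

/-- Integrability on the product Gaussian of products of the one-particle functions used. [folklore] -/
theorem integrable_pi_gM_coord (i j : Fin (N + 1)) :
    Integrable (fun v : Fin (N + 1) → V3 => gM (v i) * (v j) 0) (Measure.pi fun _ : Fin (N + 1) => stdGaussian V3) := by
  have hj : Integrable (fun v : Fin (N + 1) → V3 => (v j) 0) (Measure.pi fun _ : Fin (N + 1) => stdGaussian V3) :=
    ((measurePreserving_eval (fun _ : Fin (N + 1) => stdGaussian V3) j).integrable_comp
      integrable_coord.aestronglyMeasurable).2 integrable_coord
  exact hj.bdd_mul (c := 5) ((continuous_gM.measurable.comp (measurable_pi_apply i)).aestronglyMeasurable)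
    (Eventually.of_forall fun v => by rw [Real.norm_eq_abs]; exact abs_gM_le _)

/-- Helper for the Mazur-floor refutation (see the module docstring). [folklore] -/
theorem integrable_pi_coord_coord (i j : Fin (N + 1)) :
    Integrable (fun v : Fin (N + 1) → V3 => (v i) 0 * (v j) 0) (Measure.pi fun _ : Fin (N + 1) => stdGaussian V3) := by
  have hmem : ∀ k : Fin (N + 1), MemLp (fun v : Fin (N + 1) → V3 => (v k) 0) 2 (Measure.pi fun _ : Fin (N + 1) => stdGaussian V3) :=
    fun k => (memLp_coord_stdGaussian (0 : Fin 3) 2 (by simp)).comp_measurePreserving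
      (measurePreserving_eval (fun _ : Fin (N + 1) => stdGaussian V3) k)
  exact (hmem i).integrable_mul (hmem j)

/-- `E_{G_N}[F P] = (N+1) m`. [folklore] -/
theorem integral_Fobs_mul_Pobs (hσ : σ ≤ 1 / 2)
    (Φ : HardSphereFlow (Torus.geometry (Fin 3)) (hsDiameter σ N) (N + 1)) :
    ∫ z, Fobs z * Pobs z ∂(localGibbsLaw σ (fun _ => 1) (fun _ => 0) (fun _ => 1) N Φ) = ((N : ℝ) + 1) * mM := by
  have hH : Measurable fun v : Fin (N + 1) → V3 => (∑ i, gM (v i)) * (∑ j, v j 0) :=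
    (Finset.measurable_sum _ fun i _ => continuous_gM.measurable.comp (measurable_pi_apply i)).mul
      (Finset.measurable_sum _ fun j _ => (EuclideanSpace.proj (𝕜 := ℝ) (0 : Fin 3)).continuous.measurable.comp (measurable_pi_apply j))
  have h1 := integral_velOf_localGibbsLaw hσ N Φ hH
  simp only [Fobs_eq_velOf, Pobs_eq_velOf]
  rw [h1, integral_sum_mul_sum (stdGaussian V3) measurePreserving_neg_stdGaussian gM (fun w => w 0) gM_neg
    continuous_gM.measurable (EuclideanSpace.proj (𝕜 := ℝ) (0 : Fin 3)).continuous.measurable integrable_pi_gM_coord]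
  rw [mM]
  push_cast
  ring

/-- `E_{G_N}[P²] = N+1`. [folklore] -/
theorem integral_Pobs_sq (hσ : σ ≤ 1 / 2)
    (Φ : HardSphereFlow (Torus.geometry (Fin 3)) (hsDiameter σ N) (N + 1)) :
    ∫ z, Pobs z * Pobs z ∂(localGibbsLaw σ (fun _ => 1) (fun _ => 0) (fun _ => 1) N Φ) = ((N : ℝ) + 1) := by
  have hH : Measurable fun v : Fin (N + 1) → V3 => (∑ i, v i 0) * (∑ j, v j 0) :=
    (Finset.measurable_sum _ fun j _ => (EuclideanSpace.proj (𝕜 := ℝ) (0 : Fin 3)).continuous.measurable.comp (measurable_pi_apply j)).mul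
      (Finset.measurable_sum _ fun j _ => (EuclideanSpace.proj (𝕜 := ℝ) (0 : Fin 3)).continuous.measurable.comp (measurable_pi_apply j))
  have h1 := integral_velOf_localGibbsLaw hσ N Φ hH
  simp only [Pobs_eq_velOf]
  rw [h1, integral_sum_mul_sum (stdGaussian V3) measurePreserving_neg_stdGaussian (fun w => w 0) (fun w => w 0)
    (fun w => rfl) (EuclideanSpace.proj (𝕜 := ℝ) (0 : Fin 3)).continuous.measurable
    (EuclideanSpace.proj (𝕜 := ℝ) (0 : Fin 3)).continuous.measurable integrable_pi_coord_coord]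
  have : ∫ w : V3, w 0 * w 0 ∂stdGaussian V3 = 1 := by
    simp_rw [← sq]
    exact integral_coord_sq_stdGaussian 0
  rw [this, mul_one]
  push_cast
  ring

/-- `F`, `P`, `F P`, `P²` are `G_N`-integrable. [folklore] -/
theorem integrable_Pobs (hσ : σ ≤ 1 / 2)
    (Φ : HardSphereFlow (Torus.geometry (Fin 3)) (hsDiameter σ N) (N + 1)) :
    Integrable (Pobs : Config (N + 1) (Fin 3) T3 → ℝ) (localGibbsLaw σ (fun _ => 1) (fun _ => 0) (fun _ => 1) N Φ) := by
  rw [Pobs_eq_velOf']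
  refine integrable_velOf_localGibbsLaw hσ N Φ (H := fun v : Fin (N + 1) → V3 => ∑ i, v i 0) ?_
  refine integrable_finsetSum (μ := Measure.pi fun _ : Fin (N + 1) => stdGaussian V3) Finset.univ
    (f := fun (i : Fin (N + 1)) (v : Fin (N + 1) → V3) => v i 0) fun i _ => ?_
  exact ((measurePreserving_eval (fun _ : Fin (N + 1) => stdGaussian V3) i).integrable_comp
    integrable_coord.aestronglyMeasurable).2 integrable_coord

/-- Helper for the Mazur-floor refutation (see the module docstring). [folklore] -/
theorem integrable_Pobs_sq (hσ : σ ≤ 1 / 2)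
    (Φ : HardSphereFlow (Torus.geometry (Fin 3)) (hsDiameter σ N) (N + 1)) :
    Integrable (fun z : Config (N + 1) (Fin 3) T3 => Pobs z * Pobs z)
      (localGibbsLaw σ (fun _ => 1) (fun _ => 0) (fun _ => 1) N Φ) := by
  simp only [Pobs_eq_velOf]
  refine integrable_velOf_localGibbsLaw hσ N Φ (H := fun v => (∑ i, v i 0) * (∑ j, v j 0)) ?_
  have e : (fun v : Fin (N + 1) → V3 => (∑ i, v i 0) * (∑ j, v j 0)) =
      fun v => ∑ i, ∑ j, v i 0 * v j 0 := by
    funext v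
    rw [Finset.sum_mul_sum]
  rw [e]
  refine integrable_finsetSum (μ := Measure.pi fun _ : Fin (N + 1) => stdGaussian V3) Finset.univ
    (f := fun (i : Fin (N + 1)) (v : Fin (N + 1) → V3) => ∑ j, v i 0 * v j 0) fun i _ => ?_
  exact integrable_finsetSum (μ := Measure.pi fun _ : Fin (N + 1) => stdGaussian V3) Finset.univ
    (f := fun (j : Fin (N + 1)) (v : Fin (N + 1) → V3) => v i 0 * v j 0) fun j _ => integrable_pi_coord_coord i j

/-- Helper for the Mazur-floor refutation (see the module docstring). [folklore] -/
theorem integrable_Fobs (Φ : HardSphereFlow (Torus.geometry (Fin 3)) (hsDiameter σ N) (N + 1))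
    [IsProbabilityMeasure (localGibbsLaw σ (fun _ => 1) (fun _ => 0) (fun _ => 1) N Φ)] :
    Integrable (Fobs : Config (N + 1) (Fin 3) T3 → ℝ) (localGibbsLaw σ (fun _ => 1) (fun _ => 0) (fun _ => 1) N Φ) :=
  (integrable_const (5 * ((N : ℝ) + 1))).mono' measurable_Fobs.aestronglyMeasurable
    (Eventually.of_forall fun w => by rw [Real.norm_eq_abs]; exact abs_Fobs_le w)

/-- Helper for the Mazur-floor refutation (see the module docstring). [folklore] -/
theorem integrable_Fobs_mul_Pobs (hσ : σ ≤ 1 / 2)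
    (Φ : HardSphereFlow (Torus.geometry (Fin 3)) (hsDiameter σ N) (N + 1)) :
    Integrable (fun z : Config (N + 1) (Fin 3) T3 => Fobs z * Pobs z)
      (localGibbsLaw σ (fun _ => 1) (fun _ => 0) (fun _ => 1) N Φ) :=
  (integrable_Pobs hσ Φ).bdd_mul (c := 5 * ((N : ℝ) + 1)) measurable_Fobs.aestronglyMeasurable
    (Eventually.of_forall fun w => by rw [Real.norm_eq_abs]; exact abs_Fobs_le w)

/-- **MAZUR'S FLOOR FOR HARD SPHERES** (finite `N`, mechanised): under the stationary Gibbs law the kinetic-window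
average `A = h⁻¹∫₀ʰ F∘Φ_r` of `F = Σ g_M(vᵢ)` satisfies `E[A²] ≥ (N+1) m²`, `m = E γ[g_M w₀] ≥ 1/2` — the projection
of `F` on the conserved momentum is ballistic (Cauchy–Schwarz with `E[A P] = E[F P]`, which uses joint measurability
of the flow, Fubini, stationarity and momentum conservation). [folklore] -/
theorem mazur_floor (hσ : σ ≤ 1 / 2)
    (Φ : HardSphereFlow (Torus.geometry (Fin 3)) (hsDiameter σ N) (N + 1)) {h : ℝ} (hh : 0 < h) :
    ((N : ℝ) + 1) * mM ^ 2 ≤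
      ∫ z, (h⁻¹ * ∫ r in (0 : ℝ)..h, Fobs (Φ.flow r z)) ^ 2 ∂(localGibbsLaw σ (fun _ => 1) (fun _ => 0) (fun _ => 1) N Φ) := by
  haveI : IsProbabilityMeasure (localGibbsLaw σ (fun _ => (1 : ℝ)) (fun _ => (0 : V3)) (fun _ => (1 : ℝ)) N Φ) :=
    isProbabilityMeasure_localGibbsLaw continuous_const continuous_const
      continuous_const (fun _ => one_pos) (fun _ => one_pos) hσ N Φ
  obtain ⟨A, hA⟩ : ∃ A : Config (N + 1) (Fin 3) T3 → ℝ, A = fun z => h⁻¹ * ∫ r in (0 : ℝ)..h, Fobs (Φ.flow r z) :=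
    ⟨_, rfl⟩
  -- pointwise bound on A
  have hAbd : ∀ z, |A z| ≤ 5 * ((N : ℝ) + 1) := by
    intro z
    have hI : ‖∫ r in (0 : ℝ)..h, Fobs (Φ.flow r z)‖ ≤ 5 * ((N : ℝ) + 1) * |h - 0| :=
      intervalIntegral.norm_integral_le_of_norm_le_const fun r _ => by
        rw [Real.norm_eq_abs]; exact abs_Fobs_le _
    rw [Real.norm_eq_abs, sub_zero, abs_of_pos hh] at hI
    rw [hA, abs_mul, abs_inv, abs_of_pos hh]
    calc h⁻¹ * |∫ r in (0 : ℝ)..h, Fobs (Φ.flow r z)| ≤ h⁻¹ * (5 * ((N : ℝ) + 1) * h) :=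
          mul_le_mul_of_nonneg_left hI (by positivity)
      _ = 5 * ((N : ℝ) + 1) := by field_simp
  -- integrability of the window (Fubini infrastructure)
  have hwin : Integrable (fun z => ∫ r in (0 : ℝ)..h, Fobs (Φ.flow r z))
      (localGibbsLaw σ (fun _ => 1) (fun _ => 0) (fun _ => 1) N Φ) :=
    integrable_window 1 1 0 Φ measurable_Fobs (integrable_Fobs Φ) hh.le
  have hAm : AEStronglyMeasurable A (localGibbsLaw σ (fun _ => 1) (fun _ => 0) (fun _ => 1) N Φ) := by
    rw [hA]
    exact hwin.aestronglyMeasurable.const_mul _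
  have hA2 : Integrable (fun z => A z ^ 2) (localGibbsLaw σ (fun _ => 1) (fun _ => 0) (fun _ => 1) N Φ) := by
    refine (integrable_const ((5 * ((N : ℝ) + 1)) ^ 2)).mono' (hAm.pow 2) (Eventually.of_forall fun z => ?_)
    rw [Real.norm_eq_abs, abs_pow]
    exact pow_le_pow_left₀ (abs_nonneg _) (hAbd z) 2
  have hAP : Integrable (fun z => A z * Pobs z) (localGibbsLaw σ (fun _ => 1) (fun _ => 0) (fun _ => 1) N Φ) :=
    (integrable_Pobs hσ Φ).bdd_mul (c := 5 * ((N : ℝ) + 1)) hAm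
      (Eventually.of_forall fun z => by rw [Real.norm_eq_abs]; exact hAbd z)
  have hP2 := integrable_Pobs_sq hσ Φ
  -- the key identity E[A P] = (N+1) m
  have hkey : ∫ z, A z * Pobs z ∂(localGibbsLaw σ (fun _ => 1) (fun _ => 0) (fun _ => 1) N Φ) = ((N : ℝ) + 1) * mM := by
    have hae : (fun z => A z * Pobs z) =ᵐ[localGibbsLaw σ (fun _ => 1) (fun _ => 0) (fun _ => 1) N Φ]
        fun z => h⁻¹ * ∫ r in (0 : ℝ)..h, Fobs (Φ.flow r z) * Pobs (Φ.flow r z) := by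
      filter_upwards [ae_mem_good_localGibbsLaw' (N := N) 1 1 0 Φ] with z hz
      rw [hA]
      simp only [Pobs_flow Φ hz]
      rw [intervalIntegral.integral_mul_const, mul_assoc]
    rw [integral_congr_ae hae, integral_const_mul,
      integral_window_eq 1 1 0 Φ (X := fun w => Fobs w * Pobs w) (measurable_Fobs.mul measurable_Pobs)
        (integrable_Fobs_mul_Pobs hσ Φ) hh.le,
      ← mul_assoc, inv_mul_cancel₀ hh.ne', one_mul, integral_Fobs_mul_Pobs hσ Φ]
  -- Cauchy–Schwarz via a square
  have hsq : 0 ≤ ∫ z, (A z - mM * Pobs z) ^ 2 ∂(localGibbsLaw σ (fun _ => 1) (fun _ => 0) (fun _ => 1) N Φ) :=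
    integral_nonneg fun z => sq_nonneg _
  have e : (fun z => (A z - mM * Pobs z) ^ 2) =
      fun z => (A z ^ 2 - 2 * mM * (A z * Pobs z)) + mM ^ 2 * (Pobs z * Pobs z) := by
    funext z; ring
  have i1 : ∫ z, (A z ^ 2 - 2 * mM * (A z * Pobs z)) + mM ^ 2 * (Pobs z * Pobs z)
        ∂(localGibbsLaw σ (fun _ => 1) (fun _ => 0) (fun _ => 1) N Φ) =
      ∫ z, (A z ^ 2 - 2 * mM * (A z * Pobs z)) ∂(localGibbsLaw σ (fun _ => 1) (fun _ => 0) (fun _ => 1) N Φ)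
        + ∫ z, mM ^ 2 * (Pobs z * Pobs z) ∂(localGibbsLaw σ (fun _ => 1) (fun _ => 0) (fun _ => 1) N Φ) :=
    integral_add (hA2.sub (hAP.const_mul (2 * mM))) (hP2.const_mul (mM ^ 2))
  have i2 : ∫ z, (A z ^ 2 - 2 * mM * (A z * Pobs z)) ∂(localGibbsLaw σ (fun _ => 1) (fun _ => 0) (fun _ => 1) N Φ) =
      ∫ z, A z ^ 2 ∂(localGibbsLaw σ (fun _ => 1) (fun _ => 0) (fun _ => 1) N Φ)
        - ∫ z, 2 * mM * (A z * Pobs z) ∂(localGibbsLaw σ (fun _ => 1) (fun _ => 0) (fun _ => 1) N Φ) :=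
    integral_sub hA2 (hAP.const_mul (2 * mM))
  have i3 : ∫ z, 2 * mM * (A z * Pobs z) ∂(localGibbsLaw σ (fun _ => 1) (fun _ => 0) (fun _ => 1) N Φ) =
      2 * mM * (((N : ℝ) + 1) * mM) := by
    rw [integral_const_mul, hkey]
  have i4 : ∫ z, mM ^ 2 * (Pobs z * Pobs z) ∂(localGibbsLaw σ (fun _ => 1) (fun _ => 0) (fun _ => 1) N Φ) =
      mM ^ 2 * ((N : ℝ) + 1) := by
    rw [integral_const_mul, integral_Pobs_sq hσ Φ]
  rw [e, i1, i2, i3, i4] at hsq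
  have hAA : ∫ z, A z ^ 2 ∂(localGibbsLaw σ (fun _ => 1) (fun _ => 0) (fun _ => 1) N Φ) =
      ∫ z, (h⁻¹ * ∫ r in (0 : ℝ)..h, Fobs (Φ.flow r z)) ^ 2 ∂(localGibbsLaw σ (fun _ => 1) (fun _ => 0) (fun _ => 1) N Φ) := by
    rw [hA]
  rw [← hAA]
  nlinarith [hsq, sq_nonneg mM]

end MazurFloor


end BoltzmannGreenKuboOrthMomentum

end Summit.AtomisticToContinuum.HydrodynamicLimit.Theorems

end
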